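import Summits.CriticalPhenomena.CardyFormulaZ2.Theorems.CardyBondTriangularSwitchingReductionContourFaces

/-!
# Route CardyBondTriangular — Lemma 13 with the SIGNED colour-switching defect

Support of the informal route item `SwitchingReduction` (stmt-CriticalPhenomena-5004). The
route's crux `MesoscopicColourSwitching` (stmt-CriticalPhenomena-5003) controls, for the
Chayes–Lei representation of critical bond percolation on `𝕋`, the SIGNED weighted sum
`Σ_{w ∈ C°} Σ_j (δ z_j - δ w)(h^{i+1}_δ(w, z_{j+1}) - hⁱ_δ(w, z_j))` over the faces `C°` inside a
lattice triangular contour (the faces of the discrete domain all of whose vertices lie in the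
closed solid triangle) by `n δ e(δ)`, `e → 0`. This is exactly the quantity `ω⁻¹ (S_{i+1} - ω S_i)`
of Bollobás–Riordan's proof of Lemma 13 (*Percolation* (2006), Ch. 7, pp. 181–182, (13)–(15)),
so the summation by parts needs NO colour-switching hypothesis at all if that term is kept:

* `norm_discreteTriangleIntegral_sub_mul_le_local_signed` (local coordinates):
  `‖∮ᴰ_C F^{i+1} - ω ∮ᴰ_C F^i‖ ≤ 6 n |s| ε + |2ζ - 1| · ‖Σ_{κ ∈ C°} Σ_j (c(z_j) - c(κ))(g^{i+1}(κ, z_{j+1}) - gⁱ(κ, z_j))‖`;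
* `norm_discreteTriangleIntegral_sub_mul_le_signed` (faces of `δ𝕋`, `δ > 0`, both signs of the
  mesh): the same with the sum over the finite set of faces with vertices in the solid triangle,
  in the indexing of `MesoscopicColourSwitching` — using the identification of that set with
  `C°` (`exists_localToHex(Neg)_of_vertices`, `CardyBondTriangularSwitchingReductionContourFaces`).

## References

* B. Bollobás, O. Riordan, *Percolation*, Cambridge University Press (2006), Ch. 7, Lemma 13
  pp. 181–182, (10)–(17).
-/

noncomputable section

namespace Summit.CriticalPhenomena.CardyFormulaZ2.Theorems

open Set
open Literature.Probability.Percolation Literature.Probability.LatticeModels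

/-! ### Lemma 13 with the SIGNED (weighted) colour-switching defect -/

/-- **Bollobás–Riordan's Lemma 13 with the signed colour-switching defect, in local
coordinates.** Without any hypothesis (14), the summation by parts of Lemma 13 (Bollobás–Riordan
2006, pp. 181–182) gives
`∮ᴰ_C F^{i+1} - ω ∮ᴰ_C F^i = (2ζ - 1)(S_{i+1} - ω S_i) + (boundary terms of modulus ≤ 6 n |s| ε)`
with `S_{i+1} - ω S_i = ω · Σ_{w ∈ C°} Σ_j (z_j - w)(g^{i+1}(w, z_{j+1}) - gⁱ(w, z_j))` ((13) and
the re-indexing `j ↦ j + 1`), whence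
`‖∮ᴰ_C F^{i+1} - ω ∮ᴰ_C F^i‖ ≤ 6 n |s| ε + |2ζ - 1| · ‖Σ_{w ∈ C°} Σ_j (z_j - w)(g^{i+1}(w, z_{j+1}) - gⁱ(w, z_j))‖`
(`|2ζ - 1| = √3`). [cite: BollobasRiordan2006, Ch. 7 Lemma 13 pp. 181–182] -/
theorem norm_discreteTriangleIntegral_sub_mul_le_local_signed (F : Fin 3 → ℂ → ℝ)
    (g : Fin 3 → LocalFace → LocalFace → ℝ) (p : ℂ) (s : ℝ) (n : ℕ) {ε : ℝ}
    (h10 : ∀ κ ∈ localInterior n, ∀ j : Fin 3, localFaceNbr κ j ∈ localInterior n → ∀ i : Fin 3,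
      F i (localFaceCentre p s (localFaceNbr κ j)) - F i (localFaceCentre p s κ) =
        g i κ (localFaceNbr κ j) - g i (localFaceNbr κ j) κ)
    (h12 : ∀ κ ∈ localInterior n, ∀ i j : Fin 3, |g i κ (localFaceNbr κ j)| ≤ ε)
    (i : Fin 3) :
    ‖discreteTriangleIntegral (F (i + 1)) p s n -
        triZeta ^ 2 * discreteTriangleIntegral (F i) p s n‖ ≤
      6 * n * |s| * ε + ‖2 * triZeta - 1‖ * ‖∑ κ ∈ localInterior n, ∑ j : Fin 3,
        (localFaceCentre p s (localFaceNbr κ j) - localFaceCentre p s κ) *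
          ((g (i + 1) κ (localFaceNbr κ (j + 1)) - g i κ (localFaceNbr κ j) : ℝ) : ℂ)‖ := by
  -- the sums `S_i = S'_i + S''_i` of Bollobás–Riordan, p. 182
  set S : Fin 3 → ℂ := fun i => ∑ q ∈ localPairs n,
    (localFaceCentre p s (localFaceNbr q.1 q.2) - localFaceCentre p s q.1) *
      (g i q.1 (localFaceNbr q.1 q.2) : ℂ) with hS
  set So : Fin 3 → ℂ := fun i => ∑ q ∈ outerPairs n,
    (localFaceCentre p s (localFaceNbr q.1 q.2) - localFaceCentre p s q.1) *
      (g i q.1 (localFaceNbr q.1 q.2) : ℂ) with hSo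
  set Si : Fin 3 → ℂ := fun i => ∑ q ∈ innerPairs n,
    (localFaceCentre p s (localFaceNbr q.1 q.2) - localFaceCentre p s q.1) *
      (g i q.1 (localFaceNbr q.1 q.2) : ℂ) with hSi
  have hsplit : ∀ i, S i = Si i + So i := fun i =>
    sum_localPairs_eq_inner_add_outer n _
  -- (15), signed: `(2ζ - 1)(S_{i+1} - ω S_i) = (2ζ - 1) ω Δ`
  have h15 : (2 * triZeta - 1) * (S (i + 1) - triZeta ^ 2 * S i) =
      (2 * triZeta - 1) * triZeta ^ 2 * ∑ κ ∈ localInterior n, ∑ j : Fin 3,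
        (localFaceCentre p s (localFaceNbr κ j) - localFaceCentre p s κ) *
          ((g (i + 1) κ (localFaceNbr κ (j + 1)) - g i κ (localFaceNbr κ j) : ℝ) : ℂ) := by
    have e : ∀ κ : LocalFace,
        ∑ j : Fin 3, (localFaceCentre p s (localFaceNbr κ j) - localFaceCentre p s κ) *
            (g (i + 1) κ (localFaceNbr κ j) : ℂ) =
          ∑ j : Fin 3, triZeta ^ 2 *
            (localFaceCentre p s (localFaceNbr κ j) - localFaceCentre p s κ) *
              (g (i + 1) κ (localFaceNbr κ (j + 1)) : ℂ) := by
      intro κ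
      rw [← Equiv.sum_comp (Equiv.addRight (1 : Fin 3))]
      simp only [Equiv.coe_addRight]
      refine Finset.sum_congr rfl fun j _ => ?_
      rw [localFaceCentre_nbr_succ_sub]
    have hA : S (i + 1) = ∑ κ ∈ localInterior n, ∑ j : Fin 3, triZeta ^ 2 *
        (localFaceCentre p s (localFaceNbr κ j) - localFaceCentre p s κ) *
          (g (i + 1) κ (localFaceNbr κ (j + 1)) : ℂ) := by
      simp only [hS, localPairs, Finset.sum_product]
      exact Finset.sum_congr rfl fun κ _ => e κ
    have hB : S i = ∑ κ ∈ localInterior n, ∑ j : Fin 3,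
        (localFaceCentre p s (localFaceNbr κ j) - localFaceCentre p s κ) *
          (g i κ (localFaceNbr κ j) : ℂ) := by
      simp only [hS, localPairs, Finset.sum_product]
    rw [hA, hB, Finset.mul_sum, ← Finset.sum_sub_distrib, Finset.mul_sum, Finset.mul_sum]
    refine Finset.sum_congr rfl fun κ _ => ?_
    rw [Finset.mul_sum, ← Finset.sum_sub_distrib, Finset.mul_sum, Finset.mul_sum]
    refine Finset.sum_congr rfl fun j _ => ?_
    push_cast
    ring
  -- (17) with (10): the inner sum is `c ∮ᴰ F^i`
  have h17 : ∀ i, Si i = hexRot * discreteTriangleIntegral (F i) p s n := by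
    intro i
    have h1 := sum_innerPairs_eq p s n (fun z => (F i z : ℂ)) (fun κ κ' => (g i κ κ' : ℂ))
      (fun q hq => by
        rw [mem_innerPairs] at hq
        exact_mod_cast h10 q.1 hq.1 q.2 hq.2 i)
    have h0 := sum_localPairs_sub_mul_eq_zero p s n (fun z => (F i z : ℂ))
    rw [sum_localPairs_eq_inner_add_outer,
      sum_outerPairs_eq_hexRot_mul_discreteTriangleIntegral] at h0
    have h2 : ∑ q ∈ innerPairs n, (localFaceCentre p s q.1 -
          localFaceCentre p s (localFaceNbr q.1 q.2)) * (F i (localFaceCentre p s q.1) : ℂ) =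
        -∑ q ∈ innerPairs n, (localFaceCentre p s (localFaceNbr q.1 q.2) -
          localFaceCentre p s q.1) * (F i (localFaceCentre p s q.1) : ℂ) := by
      rw [← Finset.sum_neg_distrib]
      refine Finset.sum_congr rfl fun q _ => ?_
      ring
    simp only [hSi]
    rw [h1, h2]
    linear_combination -h0
  -- (16)
  have h16 : ∀ i, ‖(2 * triZeta - 1) * So i‖ ≤ 3 * n * |s| * ε := fun i =>
    norm_mul_sum_outerPairs_le p s n (g i) (fun κ hκ j => h12 κ hκ i j)
  -- assembly
  have hkey : discreteTriangleIntegral (F (i + 1)) p s n -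
      triZeta ^ 2 * discreteTriangleIntegral (F i) p s n =
      (2 * triZeta - 1) * (S (i + 1) - triZeta ^ 2 * S i) +
        (triZeta ^ 2 * ((2 * triZeta - 1) * So i) - (2 * triZeta - 1) * So (i + 1)) := by
    have hc := two_triZeta_sub_one_mul_hexRot
    have e1 := hsplit i
    have e2 := hsplit (i + 1)
    rw [h17] at e1 e2
    linear_combination (-(discreteTriangleIntegral (F (i + 1)) p s n) +
      triZeta ^ 2 * discreteTriangleIntegral (F i) p s n) * hc -
      (2 * triZeta - 1) * e2 + triZeta ^ 2 * (2 * triZeta - 1) * e1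
  rw [hkey]
  calc ‖(2 * triZeta - 1) * (S (i + 1) - triZeta ^ 2 * S i) +
        (triZeta ^ 2 * ((2 * triZeta - 1) * So i) - (2 * triZeta - 1) * So (i + 1))‖
      ≤ ‖(2 * triZeta - 1) * (S (i + 1) - triZeta ^ 2 * S i)‖ +
        ‖triZeta ^ 2 * ((2 * triZeta - 1) * So i) - (2 * triZeta - 1) * So (i + 1)‖ :=
        norm_add_le _ _
    _ ≤ ‖2 * triZeta - 1‖ * ‖∑ κ ∈ localInterior n, ∑ j : Fin 3,
          (localFaceCentre p s (localFaceNbr κ j) - localFaceCentre p s κ) *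
            ((g (i + 1) κ (localFaceNbr κ (j + 1)) - g i κ (localFaceNbr κ j) : ℝ) : ℂ)‖ +
        (3 * n * |s| * ε + 3 * n * |s| * ε) := by
        refine add_le_add (le_of_eq ?_) ((norm_sub_le _ _).trans (add_le_add ?_ (h16 (i + 1))))
        · rw [h15, norm_mul, norm_mul, norm_pow, norm_triZeta, one_pow, mul_one]
        · rw [norm_mul, norm_pow, norm_triZeta, one_pow, one_mul]
          exact h16 i
    _ = _ := by ring

/-- **Bollobás–Riordan's Lemma 13 with the signed colour-switching defect, on `δ𝕋`.** For
`δ > 0`, a lattice triangular contour `C : p → p + n s → p + n s ζ → p` (`p = triMeshPoint δ x₀`,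
`s = ± δ`), the finite set `C°` of faces of `δ𝕋` all of whose vertices lie in the closed solid
triangle of `C`, face values `F` and pair values `g` satisfying (10) and (12) `|g| ≤ ε` at the
faces with centre in a set `K` containing the solid triangle:
`‖∮ᴰ_C F^{i+1} dz - ω ∮ᴰ_C F^i dz‖ ≤ 6 n δ ε + |2ζ - 1| · ‖Σ_{w ∈ C°} Σ_j (δ z_j - δ w)(g^{i+1}(w, z_{j+1}) - gⁱ(w, z_j))‖`
— the weighted, signed sum of colour-switching defects of the route's crux
`MesoscopicColourSwitching`. The identification of the local faces `C°` with the vertex-guarded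
faces of `δ𝕋` is `exists_localToHex_of_vertices` / `triMeshPoint_mem_convexHull_localToHex`
(both signs). [cite: BollobasRiordan2006, Ch. 7 Lemma 13 pp. 181–182] -/
theorem norm_discreteTriangleIntegral_sub_mul_le_signed {δ : ℝ} (hδ : 0 < δ) (x₀ : Site 2)
    (n : ℕ) {s : ℝ} (hs : s = δ ∨ s = -δ) (F : Fin 3 → ℂ → ℝ)
    (g : Fin 3 → HexVertex → HexVertex → ℝ) {ε : ℝ} {K : Set ℂ}
    (hK : convexHull ℝ ({triMeshPoint δ x₀, triMeshPoint δ x₀ + n * s,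
      triMeshPoint δ x₀ + n * s * triZeta} : Set ℂ) ⊆ K)
    (C : Finset HexVertex)
    (hC : ∀ w : HexVertex, w ∈ C ↔ ∀ v ∈ hexFaceVertices w, triMeshPoint δ v ∈
      convexHull ℝ ({triMeshPoint δ x₀, triMeshPoint δ x₀ + n * s,
        triMeshPoint δ x₀ + n * s * triZeta} : Set ℂ))
    (h10 : ∀ w : HexVertex, (δ : ℂ) * hexCenter w ∈ K → ∀ j : Fin 3,
      (δ : ℂ) * hexCenter (oppFace w j) ∈ K → ∀ i : Fin 3,
        F i (δ * hexCenter (oppFace w j)) - F i (δ * hexCenter w) =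
          g i w (oppFace w j) - g i (oppFace w j) w)
    (h12 : ∀ w : HexVertex, (δ : ℂ) * hexCenter w ∈ K → ∀ i j : Fin 3,
      |g i w (oppFace w j)| ≤ ε) (i : Fin 3) :
    ‖discreteTriangleIntegral (F (i + 1)) (triMeshPoint δ x₀) s n -
        triZeta ^ 2 * discreteTriangleIntegral (F i) (triMeshPoint δ x₀) s n‖ ≤
      6 * n * δ * ε + ‖2 * triZeta - 1‖ * ‖∑ w ∈ C, ∑ j : Fin 3,
        ((δ : ℂ) * hexCenter (oppFace w j) - (δ : ℂ) * hexCenter w) *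
          ((g (i + 1) w (oppFace w (j + 1)) - g i w (oppFace w j) : ℝ) : ℂ)‖ := by
  classical
  -- the face map: injective, compatible with neighbours and centres, onto `C`
  obtain ⟨φ, hφi, hφn, hφc, hφv, hφs⟩ : ∃ φ : LocalFace → HexVertex, Function.Injective φ ∧
      (∀ κ j, φ (localFaceNbr κ j) = oppFace (φ κ) (j + faceShift (φ κ))) ∧
      (∀ κ, (δ : ℂ) * hexCenter (φ κ) = localFaceCentre (triMeshPoint δ x₀) s κ) ∧
      (∀ κ ∈ localInterior n, ∀ v ∈ hexFaceVertices (φ κ), triMeshPoint δ v ∈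
        convexHull ℝ ({triMeshPoint δ x₀, triMeshPoint δ x₀ + n * s,
          triMeshPoint δ x₀ + n * s * triZeta} : Set ℂ)) ∧
      ∀ w : HexVertex, (∀ v ∈ hexFaceVertices w, triMeshPoint δ v ∈
        convexHull ℝ ({triMeshPoint δ x₀, triMeshPoint δ x₀ + n * s,
          triMeshPoint δ x₀ + n * s * triZeta} : Set ℂ)) → ∃ κ ∈ localInterior n, φ κ = w := by
    rcases hs with rfl | rfl
    · exact ⟨localToHex x₀, localToHex_injective x₀, localToHex_nbr x₀, hexCenter_localToHex s x₀,
        fun κ hκ v hv => triMeshPoint_mem_convexHull_localToHex s x₀ hκ hv,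
        fun w hw => exists_localToHex_of_vertices hδ x₀ n w hw⟩
    · exact ⟨localToHexNeg x₀, localToHexNeg_injective x₀, localToHexNeg_nbr x₀,
        hexCenter_localToHexNeg δ x₀,
        fun κ hκ v hv => triMeshPoint_mem_convexHull_localToHexNeg δ x₀ hκ hv,
        fun w hw => exists_localToHexNeg_of_vertices hδ x₀ n w hw⟩
  have hsabs : |s| = δ := by
    rcases hs with rfl | rfl
    · exact abs_of_nonneg hδ.le
    · rw [abs_neg, abs_of_nonneg hδ.le]
  -- `C = φ(C°)`
  have hCeq : C = (localInterior n).image φ := by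
    ext w
    rw [hC, Finset.mem_image]
    constructor
    · exact hφs w
    · rintro ⟨κ, hκ, rfl⟩
      exact hφv κ hκ
  have hin : ∀ κ ∈ localInterior n, (δ : ℂ) * hexCenter (φ κ) ∈ K := fun κ hκ => by
    rw [hφc]; exact hK (localFaceCentre_mem_convexHull _ _ hκ)
  have key := norm_discreteTriangleIntegral_sub_mul_le_local_signed F
    (fun i κ κ' => g i (φ κ) (φ κ')) (triMeshPoint δ x₀) s n (ε := ε) ?_ ?_ i
  · rw [hsabs] at key
    have hsum : ∑ w ∈ C, ∑ j : Fin 3, ((δ : ℂ) * hexCenter (oppFace w j) - (δ : ℂ) * hexCenter w) *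
          ((g (i + 1) w (oppFace w (j + 1)) - g i w (oppFace w j) : ℝ) : ℂ) =
        ∑ κ ∈ localInterior n, ∑ j : Fin 3,
          (localFaceCentre (triMeshPoint δ x₀) s (localFaceNbr κ j) -
              localFaceCentre (triMeshPoint δ x₀) s κ) *
            ((g (i + 1) (φ κ) (φ (localFaceNbr κ (j + 1))) -
              g i (φ κ) (φ (localFaceNbr κ j)) : ℝ) : ℂ) := by
      rw [hCeq, Finset.sum_image fun κ _ κ' _ h => hφi h]
      refine Finset.sum_congr rfl fun κ _ => ?_
      symm
      conv_rhs => rw [← Equiv.sum_comp (Equiv.addRight (faceShift (φ κ)))]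
      refine Finset.sum_congr rfl fun j _ => ?_
      simp only [Equiv.coe_addRight, hφn, add_right_comm j 1 (faceShift (φ κ)), ← hφc]
    rw [hsum]
    exact key
  · intro κ hκ j hj i
    have hz : (δ : ℂ) * hexCenter (oppFace (φ κ) (j + faceShift (φ κ))) ∈ K := by
      rw [← hφn]; exact hin _ hj
    have h := h10 (φ κ) (hin κ hκ) (j + faceShift (φ κ)) hz i
    rw [← hφn, hφc, hφc] at h
    exact h
  · intro κ hκ i j
    simp only [hφn]
    exact h12 (φ κ) (hin κ hκ) i (j + faceShift (φ κ))

end Summit.CriticalPhenomena.CardyFormulaZ2.Theorems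

end
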